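/-
Copyright: the b2b-balaban T⁴-continuum CRUX team, row NE7b leaf lineage `t4-ne7b-formalise-leaf-03` (gen 142). Project licence.
-/
import Mathlib.Analysis.Convex.Strong
import Mathlib.Analysis.Calculus.Gradient.Basic
import Mathlib.Analysis.Calculus.Deriv.Comp
import Mathlib.Analysis.Calculus.Deriv.Mul
import Mathlib.Analysis.Calculus.Deriv.Add
import Mathlib.Analysis.Calculus.Deriv.Slope
import Mathlib.Analysis.InnerProductSpace.Calculus

/-!
# SECANT CURRENCY ⟹ FIRST-ORDER CURRENCY **WITHIN** THE WINDOW: a uniformly convex function with a derivative WITHIN a (possibly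
# closed) window obeys `V x + ⟪gradientWithin V K x, y − x⟫ + (m∕2)‖y − x‖² ≤ V y` ON the window — the boundary-friendly complement of
# `…LogConcaveMarginal` §5 (row NE7b, node U5c; residual (R2′) family (2), letter (ℓ1) «`λ` ON `K`»; kernel lemmas of real analysis)

Cell `pub-balaban`, sub-cell `t4`, spine estimate NE7b (`T4WeightBudget.RelWeightBound`; the cell's OWN estimate — NOT PRINTED in
[Bałaban 1983–89], NOT PROVED).  Crux-route work under `Spine/NE7b/` by a row leaf on the convexity road; NOTHING of Bałaban's is named
or asserted; no `T4Continuum/Support` leaf typed; no `def`; zero `sorry`.  Imports: Mathlib only — independent of the farm's olean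
frontier.

WHY.  The OWNER's `…LogConcaveMarginal` (v2) §5 converts Mathlib's `StrongConvexOn K λ V` back into the sockets' first-order letter AT
points where `V` has an honest Fréchet derivative (`firstOrder_of_strongConvexOn_hasFDerivAt ∕ …_hasGradientAt`), and
`…LogConcaveMarginalDeriv` supplies that derivative for product windows at INTERIOR base points (`B ∈ 𝓝 x₀`).  At BOUNDARY points of a
CLOSED base window the windowed marginal and the fixed-fibre integral differ on one side, an ambient `HasFDerivAt` is not available, and
the natural currency is the derivative WITHIN the window (`HasFDerivWithinAt ∕ HasGradientWithinAt ∕ gradientWithin`) — refuter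
PRICING-NE7b v93 F483's located remark.  THIS FILE is that within-window conversion, at the generality of Mathlib's `UniformConvexOn`
with ANY modulus `φ` on a real normed space: the chord `t ↦ x + t(y − x)`, `t ∈ (0,1)`, stays in the window, the slope of `V` along it
tends to `V'(y − x)` WITHIN `(0,1)` and is bounded by the chord inequality divided by `t`.  The `HasFDerivAt` ∕ `HasGradientAt` forms
are NOT repeated here (they are `…LogConcaveMarginal.firstOrder_of_strongConvexOn_hasFDerivAt ∕ …_hasGradientAt`).

WHAT IS PROVED ([folklore]; Hiriart-Urruty–Lemaréchal 2001, Chap. B, Thm 4.1.1 ∕ 4.1.4 for the differentiable case):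
* §1 (real normed space, any modulus `φ`): `chordSlope_le_of_uniformConvexOn` and **`apply_add_fderivWithin_add_modulus_le`**:
  `UniformConvexOn s φ f`, `x, y ∈ s`, `HasFDerivWithinAt f f' s x` ⊢ `f x + f'(y − x) + φ ‖y − x‖ ≤ f y`; the `StrongConvexOn`
  specialisation `apply_add_fderivWithin_add_sq_le` (`+ (m∕2)‖y − x‖²`).
* §2 (real inner product space, complete): **`apply_add_inner_add_sq_le`** (`HasGradientWithinAt V g K x` ⊢
  `V x + ⟪g, y − x⟫ + (m∕2)‖y − x‖² ≤ V y`); THE ROAD'S LETTER WITHIN THE WINDOW **`firstOrderOn_within_of_strongConvexOn`** —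
  `StrongConvexOn K m V` and `∀ x ∈ K, DifferentiableWithinAt ℝ V K x` ⊢ `∀ x ∈ K, ∀ y ∈ K, V x + ⟪gradientWithin V K x, y − x⟫ + (m∕2)‖y − x‖² ≤ V y`;
  the `m = 0` corollary `firstOrderOn_within_of_convexOn`.
* §3 a non-vacuity `example` on a CLOSED window (`V = ½‖x‖²`, `m = 1`, `K` = the closed unit ball).

NOT HERE (honest): the `HasFDerivAt` forms (the OWNER's §5); the differentiability of any marginal; which of print's windows are closed
in which chart ((A3) ∕ (A1c) readings — programme-sized, NC-NE7b-α UNRULED); anything of Bałaban's.  NE7b NOT PRINTED ∕ NOT PROVED;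
spine PROVED 0∕9; rung (B)+1 on a FINITE torus — NOT infinite volume, NOT the mass gap, NOT Clay.
HONEST DEPENDENCY: continuum YM on T⁴ ⇐ BetaPertH ∧ nine spine estimates (0/9 proved); BetaPertH ⇐ (D1) ∧ (D4) ∧ CAP+tail; G-an2-4
gates asym, D1 and NE2/3/4.
-/

set_option autoImplicit false

noncomputable section

open Set Filter Topology InnerProductSpace
open scoped RealInnerProductSpace

namespace Summit.QuantumFields.BalabanUV.T4Continuum.NE7b.StrongConvexFirstOrderWithin

/-! ## §1 Uniformly convex functions on a real normed space: the one-sided derivative along a chord -/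

section Normed

variable {E : Type*} [NormedAddCommGroup E] [NormedSpace ℝ E] {s : Set E} {φ : ℝ → ℝ} {f : E → ℝ} {x y : E}

/-- The chord slope bound: for `f` uniformly convex on `s` with modulus `φ`, `x, y ∈ s` and `0 < t < 1`,
`(f(x + t(y − x)) − f x)∕t ≤ f y − f x − (1 − t)·φ(‖y − x‖)`. [folklore] -/
theorem chordSlope_le_of_uniformConvexOn (hf : UniformConvexOn s φ f) (hx : x ∈ s) (hy : y ∈ s) {t : ℝ}
    (ht : t ∈ Ioo (0 : ℝ) 1) :
    (f (x + t • (y - x)) - f x) / t ≤ f y - f x - (1 - t) * φ ‖y - x‖ := by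
  have hconv := hf.2 hx hy (sub_nonneg.2 ht.2.le) ht.1.le (sub_add_cancel 1 t)
  have hpt : (1 - t) • x + t • y = x + t • (y - x) := by
    simp only [sub_smul, one_smul, smul_sub]; abel
  rw [hpt, smul_eq_mul, smul_eq_mul, norm_sub_rev] at hconv
  rw [div_le_iff₀ ht.1]
  have e : (f y - f x - (1 - t) * φ ‖y - x‖) * t = t * f y - t * f x - (1 - t) * t * φ ‖y - x‖ := by ring
  rw [e]
  linarith

/-- **UNIFORM CONVEXITY + A DERIVATIVE WITHIN THE WINDOW ⟹ THE FIRST-ORDER LETTER WITH THE MODULUS.**  For `f` uniformly convex on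
`s` with modulus `φ`, `x, y ∈ s`, and `f` Fréchet-differentiable at `x` WITHIN `s` with derivative `f'`:
`f x + f'(y − x) + φ(‖y − x‖) ≤ f y`.  (The chord `t ↦ x + t(y − x)`, `t ∈ (0,1)`, stays in `s`; the slopes of `f` along it tend to
`f'(y − x)` and are bounded by §1's chord bound.)  Hiriart-Urruty–Lemaréchal 2001, Chap. B, Thm 4.1.1 ∕ 4.1.4. [folklore] -/
theorem apply_add_fderivWithin_add_modulus_le (hf : UniformConvexOn s φ f) (hx : x ∈ s) (hy : y ∈ s)
    {f' : E →L[ℝ] ℝ} (hd : HasFDerivWithinAt f f' s x) : f x + f' (y - x) + φ ‖y - x‖ ≤ f y := by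
  -- the chord and the restriction of `f` to it
  set ℓ : ℝ → E := fun t => x + t • (y - x) with hℓ
  have hℓ0 : ℓ 0 = x := by simp [hℓ]
  have hline : HasDerivAt ℓ (y - x) 0 := by
    simpa [hℓ] using ((hasDerivAt_id (0 : ℝ)).smul_const (y - x)).const_add x
  have hmaps : MapsTo ℓ (Ioo (0 : ℝ) 1) s := fun t ht => by
    have hmem := hf.1 hx hy (sub_nonneg.2 ht.2.le) ht.1.le (sub_add_cancel 1 t)
    have hpt : (1 - t) • x + t • y = ℓ t := by
      simp only [hℓ, sub_smul, one_smul, smul_sub]; abel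
    rwa [hpt] at hmem
  have hgd : HasDerivWithinAt (f ∘ ℓ) (f' (y - x)) (Ioo (0 : ℝ) 1) 0 := by
    have hd' : HasFDerivWithinAt f f' s (ℓ 0) := by rw [hℓ0]; exact hd
    exact hd'.comp_hasDerivWithinAt 0 hline.hasDerivWithinAt hmaps
  -- slopes along the chord tend to `f'(y − x)` from the right
  have htend : Tendsto (slope (f ∘ ℓ) 0) (𝓝[Ioo (0 : ℝ) 1] 0) (𝓝 (f' (y - x))) :=
    (hasDerivWithinAt_iff_tendsto_slope' (by simp)).1 hgd
  -- the chord bound tends to `f y − f x − φ‖y − x‖`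
  have hbound : Tendsto (fun t : ℝ => f y - f x - (1 - t) * φ ‖y - x‖) (𝓝[Ioo (0 : ℝ) 1] 0)
      (𝓝 (f y - f x - φ ‖y - x‖)) := by
    have hc : Continuous fun t : ℝ => f y - f x - (1 - t) * φ ‖y - x‖ := by fun_prop
    have h0 := hc.tendsto 0
    simp only [sub_zero, one_mul] at h0
    exact h0.mono_left nhdsWithin_le_nhds
  haveI : (𝓝[Ioo (0 : ℝ) 1] (0 : ℝ)).NeBot := left_nhdsWithin_Ioo_neBot zero_lt_one
  have hle : f' (y - x) ≤ f y - f x - φ ‖y - x‖ := by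
    refine le_of_tendsto_of_tendsto htend hbound ?_
    filter_upwards [self_mem_nhdsWithin] with t ht
    simp only [slope_def_field, Function.comp_apply, hℓ0, sub_zero]
    exact chordSlope_le_of_uniformConvexOn hf hx hy ht
  linarith

variable {m : ℝ}

/-- **`m`-STRONG CONVEXITY + A DERIVATIVE WITHIN THE WINDOW ⟹ `f x + f'(y − x) + (m∕2)‖y − x‖² ≤ f y`** (`x, y ∈ s`). [folklore] -/
theorem apply_add_fderivWithin_add_sq_le (hf : StrongConvexOn s m f) (hx : x ∈ s) (hy : y ∈ s)
    {f' : E →L[ℝ] ℝ} (hd : HasFDerivWithinAt f f' s x) : f x + f' (y - x) + m / 2 * ‖y - x‖ ^ 2 ≤ f y :=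
  apply_add_fderivWithin_add_modulus_le hf hx hy hd

end Normed

/-! ## §2 Gradient forms on a real inner product space; the road's letter verbatim -/

section Inner

variable {E : Type*} [NormedAddCommGroup E] [InnerProductSpace ℝ E] [CompleteSpace E] {K : Set E} {m : ℝ} {V : E → ℝ}
  {x y : E}

/-- **GRADIENT FORM (within the window)**: `StrongConvexOn K m V`, `x, y ∈ K`, `HasGradientWithinAt V g K x` ⊢
`V x + ⟪g, y − x⟫ + (m∕2)‖y − x‖² ≤ V y`. [folklore] -/
theorem apply_add_inner_add_sq_le (hV : StrongConvexOn K m V) (hx : x ∈ K) (hy : y ∈ K) {g : E}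
    (hd : HasGradientWithinAt V g K x) : V x + ⟪g, y - x⟫ + m / 2 * ‖y - x‖ ^ 2 ≤ V y := by
  have h := apply_add_fderivWithin_add_sq_le hV hx hy (hasGradientWithinAt_iff_hasFDerivWithinAt.1 hd)
  rwa [toDual_apply_apply] at h

/-- **THE ROAD'S FIRST-ORDER LETTER WITHIN THE WINDOW.**  If `V` is `m`-strongly convex on `K` (Mathlib's `StrongConvexOn K m V`,
e.g. the conclusion of `…LogConcaveMarginal.strongConvexOn_neg_log_fibreIntegral`) and differentiable WITHIN `K` at every point of `K`
(closed windows and boundary points allowed), then `∀ x ∈ K, ∀ y ∈ K, V x + ⟪gradientWithin V K x, y − x⟫ + (m∕2)‖y − x‖² ≤ V y` — the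
sockets' letter with the within-window gradient (at interior points of `K` it IS `gradient V x`). [folklore] -/
theorem firstOrderOn_within_of_strongConvexOn (hV : StrongConvexOn K m V) (hd : ∀ x ∈ K, DifferentiableWithinAt ℝ V K x) :
    ∀ x ∈ K, ∀ y ∈ K, V x + ⟪gradientWithin V K x, y - x⟫ + m / 2 * ‖y - x‖ ^ 2 ≤ V y :=
  fun x hx y hy => apply_add_inner_add_sq_le (y := y) hV hx hy (hd x hx).hasGradientWithinAt

/-- The `m = 0` corollary: a convex function differentiable WITHIN `K` at its points lies above its within-window tangent planes ON `K`,
`V x + ⟪gradientWithin V K x, y − x⟫ ≤ V y`. [folklore] -/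
theorem firstOrderOn_within_of_convexOn (hV : ConvexOn ℝ K V) (hd : ∀ x ∈ K, DifferentiableWithinAt ℝ V K x) :
    ∀ x ∈ K, ∀ y ∈ K, V x + ⟪gradientWithin V K x, y - x⟫ ≤ V y := by
  intro x hx y hy
  have h := firstOrderOn_within_of_strongConvexOn (strongConvexOn_zero.2 hV) hd x hx y hy
  simpa using h

end Inner

/-! ## §3 Non-vacuity -/

section Toy

variable {n : ℕ}

/-- Non-vacuity toy on a CLOSED window: every hypothesis of `firstOrderOn_within_of_strongConvexOn` is jointly inhabited — `V = ½‖x‖²`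
is `1`-strongly convex on the closed unit ball `K` (Mathlib's `strongConvexOn_iff_convex`: `V − ½‖x‖² = 0` is convex) and differentiable
within `K` at its points (boundary included). -/
example (x y : EuclideanSpace ℝ (Fin n)) (hx : x ∈ Metric.closedBall (0 : EuclideanSpace ℝ (Fin n)) 1)
    (hy : y ∈ Metric.closedBall (0 : EuclideanSpace ℝ (Fin n)) 1) :
    (fun z : EuclideanSpace ℝ (Fin n) => 1 / 2 * ‖z‖ ^ 2) x +
        ⟪gradientWithin (fun z : EuclideanSpace ℝ (Fin n) => 1 / 2 * ‖z‖ ^ 2) (Metric.closedBall 0 1) x, y - x⟫ +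
          1 / 2 * ‖y - x‖ ^ 2 ≤
      (fun z : EuclideanSpace ℝ (Fin n) => 1 / 2 * ‖z‖ ^ 2) y := by
  have hsc : StrongConvexOn (Metric.closedBall (0 : EuclideanSpace ℝ (Fin n)) 1) 1
      (fun z : EuclideanSpace ℝ (Fin n) => 1 / 2 * ‖z‖ ^ 2) := by
    rw [strongConvexOn_iff_convex]
    have e : (fun z : EuclideanSpace ℝ (Fin n) => 1 / 2 * ‖z‖ ^ 2 - 1 / (2 : ℝ) * ‖z‖ ^ 2) = fun _ => 0 := by
      funext z; ring
    rw [e]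
    exact convexOn_const 0 (convex_closedBall 0 1)
  have hdiff : ∀ z ∈ Metric.closedBall (0 : EuclideanSpace ℝ (Fin n)) 1,
      DifferentiableWithinAt ℝ (fun z : EuclideanSpace ℝ (Fin n) => 1 / 2 * ‖z‖ ^ 2) (Metric.closedBall 0 1) z :=
    fun z _ => (((hasStrictFDerivAt_norm_sq z).hasFDerivAt).const_mul (1 / 2 : ℝ)).differentiableAt.differentiableWithinAt
  exact firstOrderOn_within_of_strongConvexOn hsc hdiff x hx y hy

end Toy

end Summit.QuantumFields.BalabanUV.T4Continuum.NE7b.StrongConvexFirstOrderWithin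

end
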